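import Literature.Topology.FourManifolds.CircleSurgery
import Literature.Topology.FourManifolds.FramedTubularNbhd
import Literature.Topology.FourManifolds.TubeFromFraming
import HarnessLib

/-!
# Tubular neighbourhoods of circles from normal framings: reduction of `Literature.Topology.FourManifolds.nonempty_circleNbhd`

Topic `Literature/Topology/FourManifolds`; second file of the decomposition of the named fact
`Literature.Topology.FourManifolds.nonempty_circleNbhd` (`CircleSurgery.lean`, item `provefact-Literature.nonempty_circleNbhd`): *a
smoothly embedded circle `c : 𝕊¹ → X` in an orientable `C^∞` 4-manifold has an open tubular
neighbourhood `𝕊¹ × ℝ³ ↪ X`* (`Literature.Topology.FourManifolds.CircleNbhd`). The classical proof (Kosinski, *Differential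
Manifolds* (1993), III, Thm. 2.2 and Cor. 2.3; Gompf–Stipsicz, *4-Manifolds and Kirby Calculus*
(1999), §5.2) has two inputs: (a) the normal bundle of `c` is trivial because `X` is orientable
(Hirsch, *Differential Topology* (1976), Ch. 4 §4, Lemma 4.1 and Exercise 2), and (b) the tubular
neighbourhood theorem for a framed normal bundle. This file **states (a) as a named fact**,
`Literature.Topology.FourManifolds.exists_normalFraming_of_isOrientable` (a smooth field `N u : ℝ³ →L T_{c u} X` with
`(dc_u) ⊕ N u` bijective), and **proves (b)** and the reduction:

* `Literature.Topology.FourManifolds.exists_injOn_prod_ball_of_continuousAt` — the point-set injectivity lemma of the tree's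
  `FramedTubularNbhd.lean` with continuity assumed only at the zero section;
* `Literature.Topology.FourManifolds.mfderiv_tube_zero` — the differential at the zero section of the tube map of
  `TubeFromFraming.lean` is `(dc_u) ⊕ N u` (`mfderiv_prod_eq_add_apply`);
* `Literature.Topology.FourManifolds.nonempty_circleNbhd_of_isSmoothAlong` — framing ⇒ tubular neighbourhood: inverse function
  theorem on manifolds (`Literature.Topology.FourManifolds.isLocalDiffeomorphAt_of_mfderiv`), a uniform tube of local
  diffeomorphisms by compactness, injectivity on a smaller tube, the fibre squeeze
  `Literature.Topology.FourManifolds.prodUnivBall`, and `Literature.Topology.FourManifolds.isSmoothEmbedding_of_isLocalDiffeomorph`;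
* `Literature.nonempty_circleNbhd_of_framing : exists_normalFraming_of_isOrientable → nonempty_circleNbhd`.

## References

* A. A. Kosinski, *Differential Manifolds* (1993), III, Thm. 2.2, Cor. 2.3; VI.6 (before Cor. 6.6:
  "the only orientable disc bundle over the circle is the product bundle"). [Kosinski1993]
* M. W. Hirsch, *Differential Topology*, GTM 33 (1976), Ch. 4 §4, Lemma 4.1, Exercise 2 (p. 104);
  Ch. 4 §5, Thm. 5.1 (injectivity near the zero section, with Ch. 2 §1 Ex. 7). [HirschDT1976]
* R. Gompf, A. Stipsicz, *4-Manifolds and Kirby Calculus*, GSM 20 (1999), §5.2. [GompfStipsicz1999]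
-/

open scoped Manifold ContDiff Topology
open Set Function Filter Metric

noncomputable section

namespace Literature.Topology.FourManifolds

/-- Local notation: `𝔼 n` is the model Euclidean space `EuclideanSpace ℝ (Fin n)`. -/
local notation "𝔼 " n:arg => EuclideanSpace ℝ (Fin n)

/-- Local notation: `𝕊 n` is the unit sphere in `EuclideanSpace ℝ (Fin (n + 1))`. -/
local notation "𝕊 " n:arg => (Metric.sphere (0 : EuclideanSpace ℝ (Fin (n + 1))) 1)

/-! ### Injectivity near a compact injectively mapped zero section (local continuity) -/

section Injectivity

variable {K Y F : Type*} [TopologicalSpace K] [CompactSpace K] [TopologicalSpace Y] [T2Space Y]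
  [SeminormedAddCommGroup F]

/-- **Local injectivity plus injectivity on a compact zero section gives injectivity on a uniform
tube**, for maps only known to be continuous at the zero section (variant of the tree's
`Literature.Topology.FourManifolds.exists_injOn_prod_ball`, whose proof uses continuity of `g` at the points `(x, 0)` only):
`g : K × F → Y`, `K` compact, `Y` Hausdorff, `x ↦ g (x, 0)` injective, `g` continuous at and
injective near each `(x, 0)`; then `g` is injective on `K × B(0, ε)` for some `ε > 0` (Hirsch,
*Differential Topology* (1976), Ch. 4, proof of Thm. 5.1, with Ch. 2 §1 Exercise 7). [folklore] -/
theorem exists_injOn_prod_ball_of_continuousAt {g : K × F → Y}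
    (hg : ∀ x, ContinuousAt g (x, 0)) (h0 : Injective fun x => g (x, 0))
    (hloc : ∀ x, ∃ U ∈ 𝓝 (x, (0 : F)), InjOn g U) :
    ∃ ε > 0, InjOn g (univ ×ˢ ball (0 : F) ε) := by
  let P : F × F → K × K → Prop := fun uv xy =>
    g (xy.1, uv.1) = g (xy.2, uv.2) → xy.1 = xy.2 ∧ uv.1 = uv.2
  have hP : ∀ xy ∈ (univ : Set (K × K)), ∀ᶠ z : (F × F) × (K × K) in 𝓝 ((0, 0), xy),
      P z.1 z.2 := by
    rintro ⟨x, y⟩ -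
    have hc1 : Continuous fun z : (F × F) × (K × K) => ((z.2.1, z.1.1) : K × F) := by fun_prop
    have hc2 : Continuous fun z : (F × F) × (K × K) => ((z.2.2, z.1.2) : K × F) := by fun_prop
    have hg1 : ContinuousAt (fun z : (F × F) × (K × K) => g (z.2.1, z.1.1)) ((0, 0), (x, y)) :=
      by exact (hg x).comp_of_eq hc1.continuousAt rfl
    have hg2 : ContinuousAt (fun z : (F × F) × (K × K) => g (z.2.2, z.1.2)) ((0, 0), (x, y)) :=
      by exact (hg y).comp_of_eq hc2.continuousAt rfl
    by_cases hxy : g (x, 0) = g (y, 0)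
    · obtain rfl : x = y := h0 hxy
      obtain ⟨U, hU, hinj⟩ := hloc x
      have h1 : ∀ᶠ z : (F × F) × (K × K) in 𝓝 ((0, 0), (x, x)), (z.2.1, z.1.1) ∈ U :=
        hc1.continuousAt.preimage_mem_nhds hU
      have h2 : ∀ᶠ z : (F × F) × (K × K) in 𝓝 ((0, 0), (x, x)), (z.2.2, z.1.2) ∈ U :=
        hc2.continuousAt.preimage_mem_nhds hU
      filter_upwards [h1, h2] with z hz1 hz2 hz
      have := hinj hz1 hz2 hz
      exact ⟨congrArg Prod.fst this, congrArg Prod.snd this⟩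
    · have hopen : IsOpen {p : Y × Y | p.1 ≠ p.2} := isClosed_diagonal.isOpen_compl
      have h3 : ∀ᶠ z : (F × F) × (K × K) in 𝓝 ((0, 0), (x, y)),
          g (z.2.1, z.1.1) ≠ g (z.2.2, z.1.2) := by
        refine (hg1.prodMk hg2).preimage_mem_nhds (hopen.mem_nhds ?_)
        simpa using hxy
      filter_upwards [h3] with z hz hz'
      exact absurd hz' hz
  have key := (isCompact_univ (X := K × K)).eventually_forall_of_forall_eventually hP
  obtain ⟨ε, hε, hball⟩ := Metric.eventually_nhds_iff_ball.1 key
  refine ⟨ε, hε, ?_⟩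
  rintro ⟨x, u⟩ ⟨-, hu⟩ ⟨y, v⟩ ⟨-, hv⟩ hxy
  have huv : ((u, v) : F × F) ∈ ball (0, 0) ε := by
    rw [← ball_prod_same]
    exact ⟨hu, hv⟩
  obtain ⟨h1, h2⟩ := hball _ huv (x, y) (mem_univ _) hxy
  simp only at h1 h2
  rw [h1, h2]

end Injectivity

/-! ### The named fact: normal framings of circles in orientable 4-manifolds -/

universe u

section Framing

/-- **Normal framings of embedded circles in orientable 4-manifolds** (the normal bundle of an
embedded circle in an orientable manifold is trivial). Let `X` be an orientable `C^∞` 4-manifold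
(Hausdorff, second countable, charted on `ℝ⁴`) and `c : 𝕊¹ → X` a `C^∞` embedding. Then there is
a family `N u : ℝ³ →L[ℝ] ℝ⁴ = T_{c u} X` of linear maps into the tangent spaces along `c`,
depending smoothly on `u` (`Literature.Topology.FourManifolds.IsSmoothAlong`: smooth when read in the charts of `X`), which
together with the differential of `c` frames the tangent spaces along the circle:
`(mfderiv c u).coprod (N u) : T_u 𝕊¹ × ℝ³ → T_{c u} X` is bijective for every `u` — i.e. `N` is a
framing of the normal bundle `ν_c = c^*TX / T𝕊¹` of `c`. Source: the restriction `c^*TX` is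
orientable since `X` is, `T𝕊¹` is trivial, so `ν_c` is orientable by the two-out-of-three lemma
for `ξ ⊕ ξ' = ξ''` (Hirsch, *Differential Topology* (1976), Ch. 4, §4, Lemma 4.1), and an
orientable `n`-plane bundle over `S¹` is trivial (loc. cit., §4, Exercise 2: "There are precisely
two isomorphism classes of `n`-plane bundles over `S¹` … isomorphic if and only if both are
orientable or both are non-orientable"; Kosinski, *Differential Manifolds* (1993), VI.6, before
Cor. 6.6: "the only orientable disc bundle over the circle is the product bundle").
[cite: HirschDT1976, Ch. 4 §4, Lemma 4.1 and Exercise 2] -/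
def exists_normalFraming_of_isOrientable : Prop :=
  ∀ {X : Type u} [TopologicalSpace X] [T2Space X] [SecondCountableTopology X]
    [ChartedSpace (𝔼 4) X] [IsManifold (𝓡 4) ∞ X] (_ : IsOrientable (𝓡 4) X) (c : 𝕊 1 → X)
    (_ : Manifold.IsSmoothEmbedding (𝓡 1) (𝓡 4) ∞ c),
    ∃ N : 𝕊 1 → (𝔼 3 →L[ℝ] 𝔼 4), IsSmoothAlong (𝓡 1) c N ∧
      ∀ u : 𝕊 1, Bijective ((mfderiv (𝓡 1) (𝓡 4) c u).coprod (N u))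

end Framing

/-! ### From a normal framing to a tubular neighbourhood -/

section Assembly

variable {X : Type*} [TopologicalSpace X] [ChartedSpace (𝔼 4) X]

/-- **The differential of a tube map at the zero section.** If `G : 𝕊¹ × ℝ³ → X` is `C^∞` on an
open neighbourhood `W` of the zero section, restricts to `c` on it, and its fibre derivative at
`(u, 0)` read in the chart at `c u` is `N u`, then `mfderiv G (u, 0) = (mfderiv c u).coprod (N u)`
(the total derivative is the sum of the partial derivatives, `mfderiv_prod_eq_add_apply`).
[folklore] -/
theorem mfderiv_tube_zero {c : 𝕊 1 → X} {N : 𝕊 1 → (𝔼 3 →L[ℝ] 𝔼 4)} {G : (𝕊 1) × 𝔼 3 → X}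
    {W : Set ((𝕊 1) × 𝔼 3)} (hWo : IsOpen W) (hW0 : ∀ u, (u, (0 : 𝔼 3)) ∈ W)
    (hGW : ContMDiffOn ((𝓡 1).prod 𝓘(ℝ, 𝔼 3)) (𝓡 4) ∞ G W) (hG0 : ∀ u, G (u, 0) = c u)
    (hGd : ∀ u, HasFDerivAt (fun v : 𝔼 3 => extChartAt (𝓡 4) (c u) (G (u, v))) (N u) 0)
    (u : 𝕊 1) :
    mfderiv ((𝓡 1).prod 𝓘(ℝ, 𝔼 3)) (𝓡 4) G (u, 0) = (mfderiv (𝓡 1) (𝓡 4) c u).coprod (N u) := by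
  have hGat : ContMDiffAt ((𝓡 1).prod 𝓘(ℝ, 𝔼 3)) (𝓡 4) ∞ G (u, 0) :=
    hGW.contMDiffAt (hWo.mem_nhds (hW0 u))
  have hdiff : MDifferentiableAt ((𝓡 1).prod 𝓘(ℝ, 𝔼 3)) (𝓡 4) G (u, 0) :=
    hGat.mdifferentiableAt (by simp)
  -- the fibre derivative as an `mfderiv`
  have hfib : HasMFDerivAt 𝓘(ℝ, 𝔼 3) (𝓡 4) (fun v : 𝔼 3 => G (u, v)) 0 (N u) := by
    refine ⟨?_, ?_⟩
    · exact hGat.continuousAt.comp (by fun_prop)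
    · have h1 : writtenInExtChartAt 𝓘(ℝ, 𝔼 3) (𝓡 4) 0 (fun v : 𝔼 3 => G (u, v)) =
          fun v : 𝔼 3 => extChartAt (𝓡 4) (c u) (G (u, v)) := by
        ext v
        simp only [writtenInExtChartAt, hG0, extChartAt_model_space_eq_id, PartialEquiv.refl_symm,
          PartialEquiv.refl_coe, comp_apply, id_eq]
      rw [h1, modelWithCornersSelf_coe, range_id, hasFDerivWithinAt_univ,
        extChartAt_model_space_eq_id, PartialEquiv.refl_coe, id_eq]
      exact hGd u
  have hc' : (fun z : 𝕊 1 => G (z, 0)) = c := funext hG0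
  ext1 v
  rw [mfderiv_prod_eq_add_apply hdiff, hc', hfib.mfderiv]
  rfl

variable [T2Space X] [IsManifold (𝓡 4) ∞ X]

/-- **A normal framing of an embedded circle yields a tubular neighbourhood** (Kosinski,
*Differential Manifolds* (1993), III, Thm. 2.2 and Cor. 2.3, for the trivialised normal bundle of
a circle). Given the `C^∞` embedding `c : 𝕊¹ → X` into a `C^∞` 4-manifold and linear maps
`N u : ℝ³ →L T_{c u} X` smooth along `c` with `(dc_u, N u)` bijective, take the tube map
`G : 𝕊¹ × ℝ³ → X` of `exists_tube_of_isSmoothAlong` (`G (u, 0) = c u`, fibre derivative `N u`):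
its differential at the zero section is `(dc_u) ⊕ N u` (`mfderiv_tube_zero`), invertible, so `G`
is a local diffeomorphism near the zero section (inverse function theorem on manifolds,
`isLocalDiffeomorphAt_of_mfderiv`), on a uniform tube `𝕊¹ × B(0, ε)` by compactness, and injective
on a smaller tube since it is injective on the zero section
(`exists_injOn_prod_ball_of_continuousAt`); squeezing `ℝ³ ≅ B(0, ε)` (`prodUnivBall`) gives an
injective local diffeomorphism `𝕊¹ × ℝ³ → X`, i.e. (`isSmoothEmbedding_of_isLocalDiffeomorph`) a
`C^∞` open embedding restricting to `c` on the zero section. [folklore] -/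
theorem nonempty_circleNbhd_of_isSmoothAlong {c : 𝕊 1 → X}
    (hc : Manifold.IsSmoothEmbedding (𝓡 1) (𝓡 4) ∞ c) {N : 𝕊 1 → (𝔼 3 →L[ℝ] 𝔼 4)}
    (hN : IsSmoothAlong (𝓡 1) c N)
    (hbij : ∀ u : 𝕊 1, Bijective ((mfderiv (𝓡 1) (𝓡 4) c u).coprod (N u))) :
    Nonempty (CircleNbhd (𝓡 4) c) := by
  -- the tube map
  obtain ⟨G, ⟨W, hWo, hW0, hGW⟩, hG0, hGd⟩ :=
    exists_tube_of_isSmoothAlong (IM := 𝓡 1) (F := 𝔼 3) hc.contMDiff hN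
  have hGd' : ∀ u, HasFDerivAt (fun v : 𝔼 3 => extChartAt (𝓡 4) (c u) (G (u, v))) (N u) 0 :=
    fun u => by simpa only [frameIn_self] using hGd u (c u) (mem_chart_source _ (c u))
  -- local diffeomorphism at the zero section
  have hloc0 : ∀ u : 𝕊 1, IsLocalDiffeomorphAt ((𝓡 1).prod 𝓘(ℝ, 𝔼 3)) (𝓡 4) ∞ G (u, 0) := by
    intro u
    let L₀ : (𝔼 1 × 𝔼 3) →ₗ[ℝ] 𝔼 4 :=
      show (𝔼 1 × 𝔼 3) →ₗ[ℝ] 𝔼 4 from ((mfderiv (𝓡 1) (𝓡 4) c u).coprod (N u)).toLinearMap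
    have hb : Bijective L₀ := by exact hbij u
    let L : (𝔼 1 × 𝔼 3) ≃L[ℝ] 𝔼 4 := (LinearEquiv.ofBijective L₀ hb).toContinuousLinearEquiv
    refine isLocalDiffeomorphAt_of_mfderiv hWo (hW0 u) hGW (by simp) L ?_
    rw [mfderiv_tube_zero hWo hW0 hGW hG0 hGd' u]
    rfl
  -- a uniform tube of local diffeomorphisms
  obtain ⟨ε₁, hε₁, hloc⟩ : ∃ ε₁ > 0, ∀ q : (𝕊 1) × 𝔼 3, q.2 ∈ ball (0 : 𝔼 3) ε₁ →
      IsLocalDiffeomorphAt ((𝓡 1).prod 𝓘(ℝ, 𝔼 3)) (𝓡 4) ∞ G q := by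
    have hopen := isOpen_setOf_isLocalDiffeomorphAt (I := (𝓡 1).prod 𝓘(ℝ, 𝔼 3)) (J := 𝓡 4)
      (n := ∞) G
    have hsub : (univ : Set (𝕊 1)) ×ˢ ({0} : Set (𝔼 3)) ⊆
        {q | IsLocalDiffeomorphAt ((𝓡 1).prod 𝓘(ℝ, 𝔼 3)) (𝓡 4) ∞ G q} := by
      rintro ⟨x, v⟩ ⟨-, hv⟩
      rw [mem_singleton_iff] at hv
      subst hv
      exact hloc0 x
    obtain ⟨U, V, -, hV, hU, h0V, hUV⟩ :=
      generalized_tube_lemma isCompact_univ isCompact_singleton hopen hsub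
    obtain ⟨ε, hε, hball⟩ := Metric.isOpen_iff.1 hV 0 (h0V rfl)
    exact ⟨ε, hε, fun q hq => hUV ⟨hU (mem_univ _), hball hq⟩⟩
  -- injectivity on a uniform tube
  obtain ⟨ε₂, hε₂, hinjOn⟩ : ∃ ε₂ > 0, InjOn G ((univ : Set (𝕊 1)) ×ˢ ball (0 : 𝔼 3) ε₂) := by
    refine exists_injOn_prod_ball_of_continuousAt (fun u => ?_) ?_ fun u => ?_
    · exact (hGW.contMDiffAt (hWo.mem_nhds (hW0 u))).continuousAt
    · intro x y hxy
      simp only [hG0] at hxy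
      exact hc.isEmbedding.injective hxy
    · obtain ⟨Φ, hx, heq⟩ := hloc0 u
      exact ⟨Φ.source, Φ.open_source.mem_nhds hx, fun a ha b hb hab =>
        Φ.injOn ha hb (by rwa [← heq ha, ← heq hb])⟩
  -- the squeezed tube map
  have hε : 0 < min ε₁ ε₂ := lt_min hε₁ hε₂
  set ν : (𝕊 1) × 𝔼 3 → X :=
    fun q => G (q.1, OpenPartialHomeomorph.univBall (0 : 𝔼 3) (min ε₁ ε₂) q.2) with hν
  have hb := univBall_mem_ball (F := 𝔼 3) hε
  have hld : IsLocalDiffeomorph ((𝓡 1).prod 𝓘(ℝ, 𝔼 3)) (𝓡 4) ∞ ν := by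
    intro q
    have h1 := isLocalDiffeomorphAt_prodUnivBall (I := 𝓡 1) (M := 𝕊 1) (F := 𝔼 3) hε q
    have h2 := hloc (q.1, OpenPartialHomeomorph.univBall (0 : 𝔼 3) (min ε₁ ε₂) q.2)
      (ball_subset_ball (min_le_left _ _) (hb q.2))
    exact h1.comp (K := 𝓡 4) (P := X) h2
  have hinj : Injective ν := by
    rintro ⟨x, v⟩ ⟨y, w⟩ hq
    have hq' : G (x, OpenPartialHomeomorph.univBall (0 : 𝔼 3) (min ε₁ ε₂) v) =
        G (y, OpenPartialHomeomorph.univBall (0 : 𝔼 3) (min ε₁ ε₂) w) := hq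
    have := @hinjOn (x, OpenPartialHomeomorph.univBall (0 : 𝔼 3) (min ε₁ ε₂) v)
      ⟨mem_univ x, ball_subset_ball (min_le_right _ _) (hb v)⟩
      (y, OpenPartialHomeomorph.univBall (0 : 𝔼 3) (min ε₁ ε₂) w)
      ⟨mem_univ y, ball_subset_ball (min_le_right _ _) (hb w)⟩ hq'
    obtain ⟨hxy, hvw⟩ := Prod.mk.inj this
    rw [hxy, univBall_injective _ hvw]
  have hdim : Module.finrank ℝ (𝔼 1 × 𝔼 3) = Module.finrank ℝ (𝔼 4) := by
    simp [Module.finrank_prod]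
  exact ⟨{ toFun := ν
           isSmoothEmbedding := isSmoothEmbedding_of_isLocalDiffeomorph hld hinj
             (ContinuousLinearEquiv.ofFinrankEq hdim)
           isOpen_range := hld.isOpen_range
           apply_zero := fun u => by
             simp only [hν, OpenPartialHomeomorph.univBall_apply_zero, hG0] }⟩

/-- **Reduction of `Literature.Topology.FourManifolds.nonempty_circleNbhd` to the existence of normal framings**: a smoothly
embedded circle in an orientable 4-manifold has a tubular neighbourhood `𝕊¹ × ℝ³ ↪ X` as soon as
its normal bundle is framed (`exists_normalFraming_of_isOrientable`, where orientability enters),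
by `nonempty_circleNbhd_of_isSmoothAlong` (Kosinski (1993), III, Cor. 2.3 with VI.6;
Gompf–Stipsicz (1999), §5.2). [folklore] -/
theorem nonempty_circleNbhd_of_framing (h : exists_normalFraming_of_isOrientable.{u}) :
    nonempty_circleNbhd.{u} := by
  intro X _ _ _ _ _ hX c hc
  obtain ⟨N, hN, hbij⟩ := h hX c hc
  exact nonempty_circleNbhd_of_isSmoothAlong hc hN hbij

end Assembly

end Literature.Topology.FourManifolds
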